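import Literature.Topology.FourManifolds.HandlebodyGroupRealisation
import Literature.Topology.FourManifolds.SurfaceGroupAbelianisationKernels
import Literature.Topology.FourManifolds.SurfaceGroupSymplecticRealisation
import HarnessLib

/-!
# Cut kernels of the surface group: the erasure test, carrying one cut kernel onto another,
# and their abelian shadows

Topic `Literature/Topology/FourManifolds`; theorems only (no definitions, no named facts), over
`HandlebodyGroupRealisation.lean` (`SurfaceGroup.cutKernel c = ⟪one letter per handle: aᵢ if
c i = false, bᵢ if c i = true⟫`, the kernel of `π₁(Σ_g) → π₁` of the handlebody in which these
curves bound discs; `eraseA : S_g →* F_g`, `aQuotientEquiv`, `cutSwapEquiv`,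
`map_aKernel_cutSwapEquiv`), `SurfaceGroupAbelianisationKernels.lean` (`span_image_normalClosure`)
and `SurfaceGroupHomology.lean` (`SurfaceGroup.abelianize`).  Written for the Goeritz-group
computations of the standard Heegaard splittings (which automorphisms of `S_g` stabilise two cut
kernels at once), where membership of explicit words in a cut kernel must be decided uniformly
in the genus.

* `SurfaceGroup.mem_aKernel_iff`, `SurfaceGroup.mem_cutKernel_iff` — the ERASURE TEST: a word lies
  in `cutKernel c` iff it dies under `eraseA ∘ (cutSwapEquiv c)⁻¹` (kill the cut letters, keep the
  other letter of every handle: `S_g ⧸ cutKernel c` is free on the survivors — Zieschang–Vogt–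
  Coldewey 3.2 / the handlebody group is free); the values of the erasure on the letters
  (`erase_a_of_eq_false`, …, `erase_of_cut`) and on the middle block `mid k l` (`erase_mid`,
  `mid_mem_cutKernel`);
* `SurfaceGroup.map_cutKernel_eq_of` — an automorphism `x` of `S_g` carries `cutKernel c` onto
  `cutKernel c'` as soon as the images of the cut letters of `c` pass the erasure test of `c'`
  and the inverse images of the cut letters of `c'` pass that of `c`;
  `SurfaceGroup.map_cutKernel_cutSwapEquiv` — the cut swap `cutSwapEquiv d` flips the cut letter
  on the handles of `d`;
* `SurfaceGroup.span_abelianize_cutKernel` — the abelian shadow `[cutKernel c] ⊆ H₁ = ℤ^{2g}` is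
  the coordinate Lagrangian `span {δ_{(i, c i)}}`; `SurfaceGroup.map_span_abelianize_eq` — an
  automorphism stabilising a subgroup `N` and inducing `F` on `H₁` has `F [N] = [N]`;
* `mem_s4Gens_iff_eq` — the genus-`3` cut systems `s4Gens i` of the `S⁴` trisection pick on
  handle `r` the letter `bᵣ` iff `r + i ≡ 2 (mod 3)`.

## References

* H. B. Griffiths, *Automorphisms of a 3-dimensional handlebody*, Abh. Math. Sem. Univ. Hamburg 26
  (1964) 191–210. [GriffithsHB1964Handlebody]
* H. Zieschang, E. Vogt, H.-D. Coldewey, *Surfaces and Planar Discontinuous Groups*, LNM 835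
  (1980), §3.2, §3.6. [ZieschangVogtColdewey1980]
-/

noncomputable section

namespace Literature.Topology.FourManifolds

open Multiplicative Subgroup

variable {g : ℕ}

/-! ## The erasure test for a cut kernel -/

/-- `x ∈ ⟪aᵢ⟫ ↔ eraseA x = 1` (`S_g ⧸ ⟪aᵢ⟫ ≅ F_g` through `eraseA`). [folklore] -/
theorem SurfaceGroup.mem_aKernel_iff (x : SurfaceGroup g) :
    x ∈ SurfaceGroup.aKernel g ↔ SurfaceGroup.eraseA x = 1 := by
  refine ⟨fun h => SurfaceGroup.aKernel_le_ker_eraseA h, fun h => ?_⟩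
  rw [← QuotientGroup.eq_one_iff]
  apply (SurfaceGroup.aQuotientEquiv (g := g)).injective
  rw [map_one]
  exact h

/-- **The erasure test**: `x ∈ cutKernel c ↔ eraseA ((cutSwapEquiv c)⁻¹ x) = 1` (the cut swap
carries `⟪aᵢ⟫` onto `cutKernel c`, and `S_g ⧸ ⟪aᵢ⟫` is free on the `b̄ᵢ`). [folklore] -/
theorem SurfaceGroup.mem_cutKernel_iff (c : Fin g → Bool) (x : SurfaceGroup g) :
    x ∈ SurfaceGroup.cutKernel c ↔
      SurfaceGroup.eraseA ((SurfaceGroup.cutSwapEquiv c).symm x) = 1 := by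
  rw [← SurfaceGroup.map_aKernel_cutSwapEquiv c, ← SurfaceGroup.mem_aKernel_iff]
  exact Subgroup.mem_map_equiv

/-- Erasure of `aᵢ` when `aᵢ` is the cut letter: `1`. [folklore] -/
theorem SurfaceGroup.erase_a_of_eq_false (c : Fin g → Bool) {i : Fin g} (h : c i = false) :
    SurfaceGroup.eraseA ((SurfaceGroup.cutSwapEquiv c).symm (SurfaceGroup.a i)) = 1 := by
  rw [SurfaceGroup.cutSwapEquiv_symm_a, if_neg (by simp [h]), SurfaceGroup.eraseA_a]

/-- Erasure of `aᵢ` when `bᵢ` is the cut letter: `xᵢ⁻¹`. [folklore] -/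
theorem SurfaceGroup.erase_a_of_eq_true (c : Fin g → Bool) {i : Fin g} (h : c i = true) :
    SurfaceGroup.eraseA ((SurfaceGroup.cutSwapEquiv c).symm (SurfaceGroup.a i)) =
      (FreeGroup.of i)⁻¹ := by
  rw [SurfaceGroup.cutSwapEquiv_symm_a, if_pos h, map_inv, SurfaceGroup.eraseA_b]

/-- Erasure of `bᵢ` when `bᵢ` is the cut letter: `1`. [folklore] -/
theorem SurfaceGroup.erase_b_of_eq_true (c : Fin g → Bool) {i : Fin g} (h : c i = true) :
    SurfaceGroup.eraseA ((SurfaceGroup.cutSwapEquiv c).symm (SurfaceGroup.b i)) = 1 := by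
  rw [SurfaceGroup.cutSwapEquiv_symm_b, if_pos h, map_mul, map_mul, map_inv, SurfaceGroup.eraseA_a,
    SurfaceGroup.eraseA_b, mul_one, mul_inv_cancel]

/-- Erasure of `bᵢ` when `aᵢ` is the cut letter: `xᵢ`. [folklore] -/
theorem SurfaceGroup.erase_b_of_eq_false (c : Fin g → Bool) {i : Fin g} (h : c i = false) :
    SurfaceGroup.eraseA ((SurfaceGroup.cutSwapEquiv c).symm (SurfaceGroup.b i)) =
      FreeGroup.of i := by
  rw [SurfaceGroup.cutSwapEquiv_symm_b, if_neg (by simp [h]), SurfaceGroup.eraseA_b]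

/-- Erasure of the cut letter `(i, c i)`: `1`. [folklore] -/
theorem SurfaceGroup.erase_of_cut (c : Fin g → Bool) (i : Fin g) :
    SurfaceGroup.eraseA ((SurfaceGroup.cutSwapEquiv c).symm (PresentedGroup.of (i, c i))) = 1 := by
  cases h : c i
  · exact SurfaceGroup.erase_a_of_eq_false c h
  · exact SurfaceGroup.erase_b_of_eq_true c h

/-- The middle block `mid k l = ∏_{k<h<l} [a_h, b_h]` passes every erasure test. [folklore] -/
theorem SurfaceGroup.erase_mid (c : Fin g → Bool) (k l : ℕ) :
    SurfaceGroup.eraseA ((SurfaceGroup.cutSwapEquiv c).symm (SurfaceGroup.mid k l)) = 1 := by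
  rw [← MulEquiv.coe_toMonoidHom, ← MonoidHom.comp_apply]
  exact SurfaceGroup.map_mid_eq_one _ k l fun j => by
    cases h : c j
    · exact Or.inl (SurfaceGroup.erase_a_of_eq_false c h)
    · exact Or.inr (SurfaceGroup.erase_b_of_eq_true c h)

/-- The middle block lies in every cut kernel. [folklore] -/
theorem SurfaceGroup.mid_mem_cutKernel (c : Fin g → Bool) (k l : ℕ) :
    (SurfaceGroup.mid k l : SurfaceGroup g) ∈ SurfaceGroup.cutKernel c :=
  (SurfaceGroup.mem_cutKernel_iff c _).2 (SurfaceGroup.erase_mid c k l)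

/-! ## Carrying one cut kernel onto another -/

/-- **Generator criterion**: an automorphism `x` of `S_g` carries `cutKernel c` onto
`cutKernel c'` if the images of the cut letters of `c` pass the erasure test of `c'` and the
inverse images of the cut letters of `c'` pass the erasure test of `c`. [folklore] -/
theorem SurfaceGroup.map_cutKernel_eq_of (x : SurfaceGroup g ≃* SurfaceGroup g)
    (c c' : Fin g → Bool)
    (h1 : ∀ i, SurfaceGroup.eraseA ((SurfaceGroup.cutSwapEquiv c').symm
      (x (PresentedGroup.of (i, c i)))) = 1)
    (h2 : ∀ i, SurfaceGroup.eraseA ((SurfaceGroup.cutSwapEquiv c).symm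
      (x.symm (PresentedGroup.of (i, c' i)))) = 1) :
    (SurfaceGroup.cutKernel c).map x.toMonoidHom = SurfaceGroup.cutKernel c' :=
  RelatorAut.map_normalClosure_eq_of x _ _
    (by
      rintro _ ⟨i, rfl⟩
      exact (SurfaceGroup.mem_cutKernel_iff _ _).2 (h1 i))
    (by
      rintro _ ⟨i, rfl⟩
      exact (SurfaceGroup.mem_cutKernel_iff _ _).2 (h2 i))

/-- **The cut swap flips the cut letter on its handles**: `cutSwapEquiv d` (`aᵢ ↦ aᵢbᵢaᵢ⁻¹`,
`bᵢ ↦ aᵢ⁻¹` on the handles with `d i`) carries `cutKernel c` onto the cut kernel of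
`i ↦ if d i then ¬ c i else c i`. [folklore] -/
theorem SurfaceGroup.map_cutKernel_cutSwapEquiv (c d : Fin g → Bool) :
    (SurfaceGroup.cutKernel c).map (SurfaceGroup.cutSwapEquiv d).toMonoidHom =
      SurfaceGroup.cutKernel (fun i => if d i then !c i else c i) := by
  refine SurfaceGroup.map_cutKernel_eq_of _ _ _ (fun i => ?_) (fun i => ?_)
  · cases hc : c i <;> cases hd : d i
    · rw [← SurfaceGroup.a_def, SurfaceGroup.cutSwapEquiv_a, if_neg (by simp [hd])]
      exact SurfaceGroup.erase_a_of_eq_false _ (by simp [hc, hd])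
    · rw [← SurfaceGroup.a_def, SurfaceGroup.cutSwapEquiv_a, if_pos hd, map_mul, map_mul, map_inv,
        map_mul, map_mul, map_inv, SurfaceGroup.erase_b_of_eq_true _ (by simp [hc, hd])]
      group
    · rw [← SurfaceGroup.b_def, SurfaceGroup.cutSwapEquiv_b, if_neg (by simp [hd])]
      exact SurfaceGroup.erase_b_of_eq_true _ (by simp [hc, hd])
    · rw [← SurfaceGroup.b_def, SurfaceGroup.cutSwapEquiv_b, if_pos hd, map_inv, map_inv,
        SurfaceGroup.erase_a_of_eq_false _ (by simp [hc, hd]), inv_one]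
  · cases hd : d i
    · simp only [Bool.false_eq_true, if_false]
      cases hc : c i
      · rw [← SurfaceGroup.a_def, SurfaceGroup.cutSwapEquiv_symm_a, if_neg (by simp [hd])]
        exact SurfaceGroup.erase_a_of_eq_false _ hc
      · rw [← SurfaceGroup.b_def, SurfaceGroup.cutSwapEquiv_symm_b, if_neg (by simp [hd])]
        exact SurfaceGroup.erase_b_of_eq_true _ hc
    · simp only [if_true]
      cases hc : c i
      · rw [Bool.not_false, ← SurfaceGroup.b_def, SurfaceGroup.cutSwapEquiv_symm_b, if_pos hd,
          map_mul, map_mul, map_inv, map_mul, map_mul, map_inv, SurfaceGroup.erase_a_of_eq_false _ hc]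
        group
      · rw [Bool.not_true, ← SurfaceGroup.a_def, SurfaceGroup.cutSwapEquiv_symm_a, if_pos hd,
          map_inv, map_inv, SurfaceGroup.erase_b_of_eq_true _ hc, inv_one]

/-! ## The abelian shadow of a cut kernel -/

/-- **The abelian shadow of a cut kernel is its coordinate Lagrangian**: the image of
`cutKernel c` in `H₁ = ℤ^{2g}` spans `span {δ_{(i, c i)} : i}`. [folklore] -/
theorem SurfaceGroup.span_abelianize_cutKernel (c : Fin g → Bool) :
    Submodule.span ℤ ((fun s => toAdd (SurfaceGroup.abelianize g s)) ''
        (SurfaceGroup.cutKernel c : Set (SurfaceGroup g))) =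
      Submodule.span ℤ (Set.range fun i => (Pi.single (i, c i) (1 : ℤ) : surfaceGen g → ℤ)) := by
  rw [SurfaceGroup.cutKernel, SurfaceGroup.span_image_normalClosure, ← Set.range_comp]
  have : ((fun s => toAdd (SurfaceGroup.abelianize g s)) ∘ fun i : Fin g =>
      (PresentedGroup.of (i, c i) : SurfaceGroup g)) =
      fun i => (Pi.single (i, c i) (1 : ℤ) : surfaceGen g → ℤ) := by
    funext i
    simp
  rw [this]

/-- **Kernel stabilisers stabilise abelian shadows**: if the automorphism `x` of `S_g` stabilises
the subgroup `N` and induces `F` on `H₁`, then `F` stabilises `[N] = span (image of N)`.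
[folklore] -/
theorem SurfaceGroup.map_span_abelianize_eq (x : SurfaceGroup g ≃* SurfaceGroup g)
    (F : (surfaceGen g → ℤ) ≃ₗ[ℤ] (surfaceGen g → ℤ))
    (hreal : ∀ s, toAdd (SurfaceGroup.abelianize g (x s)) = F (toAdd (SurfaceGroup.abelianize g s)))
    (N : Subgroup (SurfaceGroup g)) (hN : N.map x.toMonoidHom = N) :
    (Submodule.span ℤ ((fun s => toAdd (SurfaceGroup.abelianize g s)) '' (N : Set _))).map
        F.toLinearMap =
      Submodule.span ℤ ((fun s => toAdd (SurfaceGroup.abelianize g s)) '' (N : Set _)) := by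
  rw [Submodule.map_span]
  congr 1
  ext v
  constructor
  · rintro ⟨_, ⟨s, hs, rfl⟩, rfl⟩
    refine ⟨x s, ?_, by simpa using hreal s⟩
    rw [← hN]
    exact ⟨s, hs, rfl⟩
  · rintro ⟨s, hs, rfl⟩
    rw [← hN] at hs
    obtain ⟨s', hs', rfl⟩ := hs
    exact ⟨_, ⟨s', hs', rfl⟩, by simpa using (hreal s').symm⟩

/-! ## The genus-`3` cut systems of the `S⁴` trisection -/

/-- The genus-`3` pattern `s4Gens i` (the letters killed by the `i`-th kernel of the trisection
of `S⁴`: `{a₀, a₁, b₂}`, `{a₀, b₁, a₂}`, `{b₀, a₁, a₂}`) picks on handle `r` exactly the letter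
`bᵣ` if `r + i ≡ 2 (mod 3)` and `aᵣ` otherwise. [folklore] -/
theorem mem_s4Gens_iff_eq (i r : Fin 3) (s : Bool) :
    (r, s) ∈ s4Gens i ↔ s = decide (((r : ℕ) + (i : ℕ)) % 3 = 2) := by
  fin_cases i <;> fin_cases r <;> cases s <;> decide

end Literature.Topology.FourManifolds

end
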